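import Mathlib
import Summits.Ventures.PercRepro2.V2SeriesClosure

/-! # The Hall reading of up-set domination (seat mine-b, cell pub-perc-repro2; MINE-B.md §19.2)

`UpDom r b` says every upper set carries non-negative `ν′`-mass, `ν′ = [B] − r·[A]` with
`A = {b = 0, r ≥ 2}` and `B = {r = 1, b ≥ 1}`.  By Hall's marriage theorem (Mathlib,
`Finset.all_card_le_biUnion_card_iff_exists_injective`) applied to the sources of `A` replicated
`r` times, this gives a **private assignment**: an injective map from the slots `(x ∈ A, i < r x)`
to `B` with `x ≤ f (x, i)` — every configuration with `b = 0`, `r ≥ 2` owns `r` private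
configurations above it with `r = 1`, `b ≥ 1` (`exists_private_targets_of_upDom`).  On a pattern
cube the colour swap turns this into the statement of MINE-B.md §19.2: every `γ` with `F_R = 0`,
`F_B = a ≥ 2` owns `a` private `γ′ ⊊ γ` with `F_B(γ′) = 1`, `F_R(γ′) ≥ 1`. -/

namespace Summit.Ventures.PercRepro2.V2Closure

open Finset

variable {X : Type*} [Preorder X] [Fintype X] [DecidableEq X] [DecidableRel (α := X) (· ≤ ·)]

/-- The sources: configurations with `b = 0` and `r ≥ 2`. -/
abbrev Src (r b : X → ℕ) := {x : X // b x = 0 ∧ 2 ≤ r x}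

/-- A bound on the labels, used to index the replicas. -/
def bound (r : X → ℕ) : ℕ := univ.sup r + 1

omit [Preorder X] [DecidableEq X] [DecidableRel (α := X) (· ≤ ·)] in
/-- every label is below the bound -/
lemma lt_bound (r : X → ℕ) (x : X) : r x < bound r :=
  Nat.lt_succ_of_le (Finset.le_sup (mem_univ x))

/-- The slots: a source `x` replicated `r x` times (`i < r x`). -/
abbrev Slot (r b : X → ℕ) := {p : Src r b × Fin (bound r) // p.2.val < r p.1.1}

/-- The admissible targets of a slot: the configurations above its source with `r = 1`, `b ≥ 1`. -/
def targets (r b : X → ℕ) (p : Slot r b) : Finset X :=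
  univ.filter (fun y => p.1.1.1 ≤ y ∧ r y = 1 ∧ 1 ≤ b y)

/-- the upper closure of the sources of a set of slots -/
def upClosure (r b : X → ℕ) (s : Finset (Slot r b)) : Finset X :=
  univ.filter (fun y => ∃ p ∈ s, p.1.1.1 ≤ y)

omit [DecidableEq X] in
/-- the upper closure is an upper set -/
lemma upClosure_isUpperSet (r b : X → ℕ) (s : Finset (Slot r b)) :
    IsUpperSet (↑(upClosure r b s) : Set X) := by
  intro y z hyz hy
  simp only [upClosure, coe_filter, mem_univ, true_and, Set.mem_setOf_eq] at hy ⊢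
  obtain ⟨p, hp, hle⟩ := hy
  exact ⟨p, hp, hle.trans hyz⟩

/-- the union of the targets of a set of slots is `B ∩ (upper closure)` -/
lemma biUnion_targets (r b : X → ℕ) (s : Finset (Slot r b)) :
    s.biUnion (targets r b) = (upClosure r b s).filter (fun y => r y = 1 ∧ 1 ≤ b y) := by
  ext y
  simp only [mem_biUnion, targets, upClosure, mem_filter, mem_univ, true_and]
  constructor
  · rintro ⟨p, hp, hle, hy⟩
    exact ⟨⟨p, hp, hle⟩, hy⟩
  · rintro ⟨⟨p, hp, hle⟩, hy⟩
    exact ⟨p, hp, hle, hy⟩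

omit [Preorder X] [DecidableRel (α := X) (· ≤ ·)] in
/-- the slots of a set over a fixed source are at most `r` of them -/
lemma card_fibre_le (r b : X → ℕ) (s : Finset (Slot r b)) (x : Src r b) :
    (s.filter (fun p => p.1.1 = x)).card ≤ r x.1 := by
  have h : (s.filter (fun p => p.1.1 = x)).card ≤ (Finset.range (r x.1)).card := by
    apply Finset.card_le_card_of_injOn (fun p => p.1.2.val)
    · intro p hp
      simp only [Finset.mem_coe, mem_filter] at hp
      simp only [Finset.coe_range, Set.mem_Iio]
      rw [← hp.2]; exact p.2
    · intro p hp q hq hpq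
      simp only [Finset.mem_coe, mem_filter] at hp hq
      apply Subtype.ext
      apply Prod.ext
      · rw [hp.2, hq.2]
      · exact Fin.ext hpq
  simpa using h

omit [Preorder X] [DecidableRel (α := X) (· ≤ ·)] in
/-- the number of slots of a set is at most the `r`-weighted number of its sources -/
lemma card_slots_le (r b : X → ℕ) (s : Finset (Slot r b)) :
    (s.card : ℤ) ≤ ∑ x ∈ s.image (fun p => p.1.1), (r x.1 : ℤ) := by
  rw [Finset.card_eq_sum_card_image (fun p => p.1.1) s]
  push_cast
  apply Finset.sum_le_sum
  intro x _
  exact_mod_cast card_fibre_le r b s x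

/-- the `r`-weighted sources of a set of slots are part of the `A`-mass of the upper closure -/
lemma sum_sources_le (r b : X → ℕ) (s : Finset (Slot r b)) :
    ∑ x ∈ s.image (fun p => p.1.1), (r x.1 : ℤ) ≤ ∑ y ∈ upClosure r b s, wA r b y := by
  have h1 : ∑ x ∈ s.image (fun p => p.1.1), (r x.1 : ℤ)
      = ∑ y ∈ (s.image (fun p => p.1.1)).map ⟨Subtype.val, Subtype.val_injective⟩, wA r b y := by
    rw [Finset.sum_map]
    apply Finset.sum_congr rfl
    intro x _
    simp only [Function.Embedding.coeFn_mk, wA, x.2.1, x.2.2, and_self, if_true]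
  rw [h1]
  apply Finset.sum_le_sum_of_subset_of_nonneg
  · intro y hy
    simp only [mem_map, mem_image, Function.Embedding.coeFn_mk] at hy
    obtain ⟨x, ⟨p, hp, hpx⟩, rfl⟩ := hy
    simp only [upClosure, mem_filter, mem_univ, true_and]
    exact ⟨p, hp, by rw [hpx]⟩
  · intro y _ _; exact wA_nonneg _ _ _

/-- **Hall's condition from up-set domination**: any set of slots has at least as many admissible
targets as slots. -/
lemma hall_condition (r b : X → ℕ) (h : UpDom r b) (s : Finset (Slot r b)) :
    s.card ≤ (s.biUnion (targets r b)).card := by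
  have hW := h (upClosure r b s) (upClosure_isUpperSet r b s)
  have hsplit : ∑ y ∈ upClosure r b s, nu' r b y
      = ∑ y ∈ upClosure r b s, indB r b y - ∑ y ∈ upClosure r b s, wA r b y := by
    rw [← Finset.sum_sub_distrib]
    exact Finset.sum_congr rfl (fun y _ => nu'_eq r b y)
  have hB : ∑ y ∈ upClosure r b s, indB r b y = ((s.biUnion (targets r b)).card : ℤ) := by
    rw [biUnion_targets, Finset.card_filter]
    push_cast
    apply Finset.sum_congr rfl
    intro y _
    simp only [indB]
  have h1 := card_slots_le r b s
  have h2 := sum_sources_le r b s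
  have : (s.card : ℤ) ≤ ((s.biUnion (targets r b)).card : ℤ) := by linarith
  exact_mod_cast this

/-- **The private assignment**: every source `x` (`b x = 0`, `r x ≥ 2`) owns `r x` private
configurations above it with `r = 1`, `b ≥ 1` — an injective map on the slots. -/
theorem exists_private_targets_of_upDom (r b : X → ℕ) (h : UpDom r b) :
    ∃ f : Slot r b → X, Function.Injective f ∧
      ∀ p : Slot r b, p.1.1.1 ≤ f p ∧ r (f p) = 1 ∧ 1 ≤ b (f p) := by
  obtain ⟨f, hf, hmem⟩ := (Finset.all_card_le_biUnion_card_iff_exists_injective (targets r b)).1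
    (hall_condition r b h)
  refine ⟨f, hf, fun p => ?_⟩
  have := hmem p
  simp only [targets, mem_filter, mem_univ, true_and] at this
  exact this

end Summit.Ventures.PercRepro2.V2Closure
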